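/-
Copyright (c) 2026 the pub-hodgecm-mathlib formalisation cell (harness21).  Prover seat hodgecm-mathlib-F0P3a-p04 (g30); dealer LH4-plan (g8) WORD #48 DEAL g8-#13 «F4-b″»
under LEAD F0P3a-plan (g15) T14-66 road M6 «ROW 2 ★ DYADIC TWIN»; sibling of LH4-p01 (g9)'s F4-b′ `TypeTwoSelfDualCyclicParityUniform` (SIG-F4b ea7bd720f84043e8), 2026-09-02.
Adapted from ★ `TypeTwoSelfDualCyclicParity` (B-p14 (g37), (D2-γ-CM)): same statement and proof in the W-UNIT (skew-unit) frame, without `|2| = 1`.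
-/
import Literature.NumberTheory.Automorphic.TypeTwoSelfDualCyclicParity      -- ★ (D2-γ-CM) sibling: brings ★ frame `SymmetricEigenframeExists`, ★ seam `RationalCyclicSelfDualLattices`, ★ bridge, ★ `exists_poly_eval_mul_eq_one`
import Literature.NumberTheory.Automorphic.WildSeamDockings                  -- ★ (P4) dockings: `even_half_log_add_log_add_of_symmetric_frame_of_skew_sq` (K2), `seed_map` (K3), `exists_v_eq_add_map_eq_one` (K1); brings ★ p851636 `RationalGoodVectorParityUniform`, ★ p851611 `WildQuadraticEisensteinFrame`
import HarnessLib

/-!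
# Self-dual cyclic lattices of a type-(2) unitary element: the parity criterion in the WILD UNIT-DISCRIMINANT frame, at ANY residue characteristic
# (Rogawski 1990 Lemma 4.9.3; Jacobowitz 1962 §5, §7, §§9–11)

Topic `NumberTheory/Automorphic`; namespace `Literature.NumberTheory.Automorphic.SymmetricEigenframe` (= ★ (D2-γ-CM)'s).  ONE THEOREM (no definition, no instance, no notation,
no named fact, no `sorry`); kernel lane `--supports stmt-HodgeConjecture-24833`.  Cell `pub/hodgecm-mathlib` (D-0151), crux H413 = `stmt-HodgeConjecture-24833`, line F0_P3c_DyadicPaydown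
(LH4), road M6 «ROW 2 ★ DYADIC TWIN» (LEAD T14-66; dealer LH4-plan (g8) WORD #48 DEAL g8-#13), brick **F4-b″** = the W-UNIT sibling of F4-b′ `exists_selfDual_cyclic_iff_even_log_uniform`
(LH4-p01 (g9)): ★ (D2-γ-CM) `exists_selfDual_cyclic_iff_even_log` with binders `h2`, `{δE} hσδE hδEv`, `htr`, `{θ} hθv hιθ hcoord`, `{N} hexpN` DELETED, and ADDED the skew-unit
frame `{α wK} (hια : ι α = −α) (hα : α * α = 1 + wK) (hw : |wK| < 1)` of ★ p851611 ∕ ★ (D2-β)′ `eigenField_package_wildUnit_of_frame` (`α² = ι₁(1 + w₀)`), the binder `hfix`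
(«`Fix ι = j(E)`», a conclusion of ★ (D2-β)′), and the linear-symmetriser seed `{ω} hω hωtr` (★ p851638); every other binder and the CONCLUSION token-identical to ★ and to F4-b′.
HONEST LABEL: count-neutral road brick (no organ, no row, no registry act); zero label movement until F5 ★ + a desk-priced rider; (O4) NOT an organ; (D-UNR)∕(D-RAM) PRINT by D74′;
`stub_N6nsDyadic` = PRINT [LS₂]; HC_CM is proved only modulo the 7 printed citations (2 remaining named inputs hLiu418 = stmt-HodgeConjecture-24832, h413 =
stmt-HodgeConjecture-24833) until rung 0 closes.  Nothing printed is asserted here — a composition of ★ material.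

THE MATHEMATICS (★'s §0–§6 with three edits).  §1 `Fix ι = j(E)` is the binder `hfix`; §2 the eigenvalues `γ = (ju, λ, ιλ)` are distinct, integral, of norm one and in the
DEPTH-ZERO regime `|γᵢ − 1| < 1` (no `|1 + γᵢ| = 1`, which is the `|2| = 1` token); §3 ★ `exists_symmetric_eigenframe`; §4 Gram values `(j d₀, d₁, ι d₁)` (no skew unit); §5 the frame
parity through the W-UNIT docking ★ `WildSeamDockings.even_half_log_add_log_add_of_symmetric_frame_of_skew_sq`: `ι det P = −det P` and anti-fixed elements have EVEN order in the
unit-discriminant frame, `L := log|λ − ιλ|` likewise even — the two wild parity flips cancel, giving `Even(log|j d₀|)` and `Even(½log|j d₀| + log|d₁| + L)` for free `L`; §6 seam ★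
`exists_selfDual_cyclic_iff_exists_rational_good` (its `htr` from the seed: ★ `exists_v_eq_add_map_eq_one`) ∘ core ★ `exists_rational_good_iff_even_uniform` (seed `jω`: ★ `seed_map`),
then `½ log|j d₀|_K = log|d₀|_E`.  The file does not know the residue characteristic.

## References
* [Rogawski1990] J. D. Rogawski, *Automorphic Representations of Unitary Groups in Three Variables* (1990), §4.9 Lemma 4.9.3 p. 56, Prop. 4.9.1 (b) p. 55.
* [Jacobowitz1962] R. Jacobowitz, *Hermitian forms over local fields*, Amer. J. Math. 84 (1962), §5, §7 Thm. 7.1, §§9–11 (ramified dyadic «R-U»).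
* [SerreLocalFields1979] J.-P. Serre, *Local Fields*, GTM 67 (1979), Ch. V §2 Prop. 3 (norms at an unramified extension), Ch. I §6.
* [Kottwitz1986] R. E. Kottwitz, *Base change for unit elements of Hecke algebras*, Compositio Math. 60 (1986), §3.
-/

set_option autoImplicit false

noncomputable section

open Finset Matrix Polynomial
open scoped MatrixGroups ValuativeRel WithZero
open ValuativeRel

namespace Literature.NumberTheory.Automorphic.SymmetricEigenframe

open Literature.NumberTheory.Automorphic Literature.NumberTheory.Automorphic.UnitaryGroup

set_option maxHeartbeats 400000 in
/-- **(D2-γ-CM)‴ «A SELF-DUAL `τ`-CYCLIC LATTICE EXISTS IFF `ord_E d₀ + n` IS EVEN» — W-UNIT (wild, even-discriminant) frame, ANY residue characteristic.**  Same hypotheses and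
conclusion as ★ `exists_selfDual_cyclic_iff_even_log` except: `h2`, `{δE} hσδE hδEv`, `htr`, `{θ} hθv hιθ hcoord`, `{N} hexpN` deleted; the skew-unit frame `{α wK} hια hα hw`
(★ `WildQuadraticEisensteinFrame` ∕ ★ `eigenField_package_wildUnit_of_frame`), `hfix` («`Fix ι = j(E)`») and the seed `{ω} hω hωtr` (★ p851638) added.
[cite: Rogawski1990, §4.9 Lemma 4.9.3 p. 56, Prop. 4.9.1 (b) p. 55] [cite: Jacobowitz1962, §5, §7 Thm. 7.1, §§9–11] [cite: SerreLocalFields1979, Ch. V §2 Prop. 3] [cite: Kottwitz1986, §3] -/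
theorem exists_selfDual_cyclic_iff_even_log_wildUnit
    {E K : Type*} [Field E] [Valued E ℤᵐ⁰] [ValuativeRel E] [(Valued.v : Valuation E ℤᵐ⁰).Compatible]
    [Field K] [Valued K ℤᵐ⁰] [ValuativeRel K] [(Valued.v : Valuation K ℤᵐ⁰).Compatible]
    -- the CM place `E = L_w`: `σ = σ_w`, norms from `σ`-fixed units (★ `UnramifiedQuadraticNorm.exists_mul_map_eq_of_isUnit_integer`), and the SEED `ω` (★ p851638)
    (σ : E →+* E) (hσσ : ∀ x, σ (σ x) = x) (hσO : ∀ x : 𝒪[E], σ x ∈ 𝒪[E])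
    (hnorm : ∀ u : 𝒪[E], IsUnit u → σ u = u → ∃ t : 𝒪[E], (t : E) * σ t = u)
    {ω : E} (hω : Valued.v ω ≤ 1) (hωtr : Valued.v (ω + σ ω) = 1)
    -- the hyperspecial hermitian form and the type-(2) unitary `τ` with its one-place data (★ (D1): `hJ hJh hτU hχ hσu hu1 hx₀ hx₀0`)
    (J : GL (Fin 3) E) (hJ : J ∈ glInt 3 E) (hJh : ((J : Matrix (Fin 3) (Fin 3) E).map σ)ᵀ = J)
    (τ : Matrix (Fin 3) (Fin 3) E) (hτU : (τ.map σ)ᵀ * (J : Matrix (Fin 3) (Fin 3) E) * τ = J)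
    {u t D : E} (hχ : τ.charpoly = (X - C u) * (X ^ 2 - C t * X + C D))
    (hσu : σ u * u = 1) (hu1 : Valued.v (u - 1) < 1)
    {x₀ : Fin 3 → E} (hx₀ : τ *ᵥ x₀ = u • x₀) (hx₀0 : x₀ ≠ 0)
    -- the ramified eigen-field `j = ι₁ : E → K` and the (D2-β)′ W-UNIT package tokens (★ `eigenField_package_wildUnit_of_frame`)
    (j : E →+* K) (hjv : ∀ x, Valued.v (j x) = Valued.v x ^ 2)
    (σK ι : K →+* K) (hσj : ∀ x, σK (j x) = j (σ x)) (hσKσK : ∀ y, σK (σK y) = y) (hσKv : ∀ y, Valued.v (σK y) = Valued.v y)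
    (hιj : ∀ x, ι (j x) = j x) (hιι : ∀ y, ι (ι y) = y) (hιv : ∀ y, Valued.v (ι y) = Valued.v y) (hσKι : ∀ y, σK (ι y) = ι (σK y))
    {α wK : K} (hια : ι α = -α) (hα : α * α = 1 + wK) (hw : Valued.v wK < 1)
    (hfix : ∀ y : K, ι y = y → ∃ x : E, j x = y)
    {lam : K} (hquad : lam ^ 2 - j t * lam + j D = 0) (hlamO : lam ∈ 𝒪[K]) (hlam1 : Valued.v (lam - 1) < 1) (hσlam : lam * σK lam = 1) (hne : ι lam ≠ lam)
    {n : ℕ} (hexpn : Valued.v (j u - lam) = WithZero.exp (-(n : ℤ)))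
    (hrE : ∀ x : K, x ≠ 0 → ι x = x → Even (WithZero.log (Valued.v x)))
    (hnK : ∀ c : K, c ≠ 0 → σK c = c → Even (WithZero.log (Valued.v c)) → ∃ a : K, a * σK a * c = 1)
    (hnE : ∀ c : K, c ≠ 0 → σK c = c → ι c = c → (4 : ℤ) ∣ WithZero.log (Valued.v c) → ∃ a : K, ι a = a ∧ a * σK a * c = 1) :
    (∃ w : Fin 3 → E, ∃ g ∈ unitaryGroupOfForm σ (J : Matrix (Fin 3) (Fin 3) E),
      Submodule.span 𝒪[E] (Set.range fun k : Fin 3 => (τ ^ (k : ℕ)) *ᵥ w) = Submodule.span 𝒪[E] (Set.range ((g : Matrix (Fin 3) (Fin 3) E))ᵀ)) ↔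
    Even (WithZero.log (Valued.v (∑ k, ∑ i, σ (x₀ i) * (J : Matrix (Fin 3) (Fin 3) E) i k * x₀ k)) + n) := by
  classical
  /- §0 valuation bookkeeping across the bridge `Valued.v ↔ valuation` -/
  have hO : ∀ x ∈ 𝒪[K], Valued.v x ≤ 1 := fun x hx => (v_le_one_iff_mem_integer x).2 hx
  have hjO : ∀ x : E, j x ∈ 𝒪[K] ↔ x ∈ 𝒪[E] := fun x => by
    rw [← v_le_one_iff_mem_integer, ← v_le_one_iff_mem_integer, hjv, pow_le_one_iff two_ne_zero]
  have hσKv' : ∀ y, valuation K (σK y) = valuation K y := fun y => (v_eq_iff_valuation_eq _ _).1 (hσKv y)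
  /- §1 `Fix ι = j(E)` (binder `hfix`, ★ (D2-β)′ W-unit package) -/
  have hιj' : ∀ y, ι y = y ↔ ∃ x, j x = y := fun y =>
    ⟨hfix y, by rintro ⟨x, rfl⟩; exact hιj x⟩
  /- §2 the eigenvalues `γ = (j u, λ, ι λ)`: non-zero, norm one, integral, `|1 + γ_i| = 1`, pairwise distinct -/
  have hσu' : σ u = u⁻¹ := eq_inv_of_mul_eq_one_left hσu
  have hu0 : u ≠ 0 := fun h => by rw [h, mul_zero] at hσu; exact zero_ne_one hσu
  have hlam0 : lam ≠ 0 := fun h => by rw [h, zero_mul] at hσlam; exact zero_ne_one hσlam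
  have hσlam' : σK lam = lam⁻¹ := eq_inv_of_mul_eq_one_right hσlam
  have hvu : Valued.v u = 1 := by
    have h := Valuation.map_one_add_of_lt (Valued.v : Valuation E ℤᵐ⁰) hu1
    rwa [add_sub_cancel] at h
  have hγO : ∀ i, (![j u, lam, ι lam] : Fin 3 → K) i ∈ 𝒪[K] := by
    intro i
    fin_cases i
    · exact (hjO u).2 ((v_le_one_iff_mem_integer u).1 hvu.le)
    · exact hlamO
    · show ι lam ∈ 𝒪[K]
      exact (v_le_one_iff_mem_integer _).1 (by rw [hιv]; exact hO _ hlamO)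
  have hσγ : ∀ i, σK ((![j u, lam, ι lam] : Fin 3 → K) i) = ((![j u, lam, ι lam] : Fin 3 → K) i)⁻¹ := by
    intro i
    fin_cases i
    · show σK (j u) = (j u)⁻¹
      rw [hσj, hσu', map_inv₀]
    · exact hσlam'
    · show σK (ι lam) = (ι lam)⁻¹
      rw [hσKι, hσlam', map_inv₀]
  have hγne : ∀ i, (![j u, lam, ι lam] : Fin 3 → K) i ≠ 0 := by
    intro i
    fin_cases i
    · exact (map_ne_zero j).2 hu0
    · exact hlam0
    · exact (map_ne_zero ι).2 hlam0
  have hγu : ∀ i, ∃ y ∈ 𝒪[K], y * (![j u, lam, ι lam] : Fin 3 → K) i = 1 := fun i =>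
    ⟨σK _, (v_le_one_iff_mem_integer _).1 (by rw [hσKv]; exact hO _ (hγO i)), by rw [hσγ, inv_mul_cancel₀ (hγne i)]⟩
  obtain ⟨r, hr⟩ := exists_poly_eval_mul_eq_one 𝒪[K] hγO hγu
  have hγ1 : ∀ i, Valued.v ((![j u, lam, ι lam] : Fin 3 → K) i - 1) < 1 := by
    intro i
    fin_cases i
    · show Valued.v (j u - 1) < 1
      rw [← map_one j, ← map_sub, hjv]
      exact pow_lt_one₀ zero_le hu1 two_ne_zero
    · exact hlam1
    · show Valued.v (ι lam - 1) < 1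
      rw [← map_one ι, ← map_sub, hιv]
      exact hlam1
  have h01 : j u ≠ lam := fun h => by
    rw [h, sub_self, map_zero] at hexpn
    exact WithZero.exp_ne_zero hexpn.symm
  have h12 : lam ≠ ι lam := fun h => hne h.symm
  have h02 : j u ≠ ι lam := fun h => h01 (by rw [← hιj u, h, hιι])
  have hinj : Function.Injective (![j u, lam, ι lam] : Fin 3 → K) := by
    intro a b hab
    fin_cases a <;> fin_cases b
    all_goals
      first
      | rfl
      | exact absurd hab h01
      | exact absurd hab.symm h01
      | exact absurd hab h02
      | exact absurd hab.symm h02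
      | exact absurd hab h12
      | exact absurd hab.symm h12
  have hιγ0 : ι ((![j u, lam, ι lam] : Fin 3 → K) 0) = (![j u, lam, ι lam] : Fin 3 → K) 0 := hιj u
  have hιγ1 : ι ((![j u, lam, ι lam] : Fin 3 → K) 1) = (![j u, lam, ι lam] : Fin 3 → K) 2 := rfl
  have hιγ2 : ι ((![j u, lam, ι lam] : Fin 3 → K) 2) = (![j u, lam, ι lam] : Fin 3 → K) 1 := hιι lam
  have h01' : WithZero.log (Valued.v ((![j u, lam, ι lam] : Fin 3 → K) 0 - (![j u, lam, ι lam] : Fin 3 → K) 1)) = -(n : ℤ) := by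
    show WithZero.log (Valued.v (j u - lam)) = _
    rw [hexpn, WithZero.log_exp]
  have h12' : WithZero.log (Valued.v ((![j u, lam, ι lam] : Fin 3 → K) 1 - (![j u, lam, ι lam] : Fin 3 → K) 2)) =
      WithZero.log (Valued.v (lam - ι lam)) := rfl
  /- §3 the symmetric eigenframe (★ frame) -/
  have hJdet : (J : Matrix (Fin 3) (Fin 3) E).det ≠ 0 := (Matrix.isUnits_det_units J).ne_zero
  have hlam : ((τ.map j).charpoly).IsRoot lam := by
    rw [Matrix.charpoly_map, hχ, Polynomial.map_mul, Polynomial.root_mul]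
    refine Or.inr ?_
    simp only [Polynomial.map_add, Polynomial.map_sub, Polynomial.map_mul, Polynomial.map_pow, Polynomial.map_X, Polynomial.map_C,
      Polynomial.IsRoot.def, Polynomial.eval_add, Polynomial.eval_sub, Polynomial.eval_mul, Polynomial.eval_pow, Polynomial.eval_X,
      Polynomial.eval_C]
    exact hquad
  obtain ⟨P, d₁, hτ, -, hP0, hP1, hP2, hGram, hd₁σ, hd₁0, hd₀0⟩ :=
    exists_symmetric_eigenframe j σ σK ι hσj hιj hσKι hιι hσKσK (J : Matrix (Fin 3) (Fin 3) E) hJh hJdet τ hτU hx₀ hx₀0 hlam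
      (by rw [mul_comm]; exact hσlam) hσu h01 h02 h12
  set d₀ : E := ∑ k, ∑ i, σ (x₀ i) * (J : Matrix (Fin 3) (Fin 3) E) i k * x₀ k with hd₀
  /- §4 the Gram values `d = (j d₀, d₁, ι d₁)` and the skew unit `δ = j δE` -/
  have hJki : ∀ i k, σ ((J : Matrix (Fin 3) (Fin 3) E) i k) = (J : Matrix (Fin 3) (Fin 3) E) k i := fun i k => by
    have h := congrFun (congrFun hJh k) i
    rwa [Matrix.transpose_apply, Matrix.map_apply] at h
  have hσd₀ : σ d₀ = d₀ := by
    rw [hd₀, map_sum]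
    simp_rw [map_sum, map_mul, hσσ, hJki]
    rw [Finset.sum_comm]
    refine Finset.sum_congr rfl fun a _ => Finset.sum_congr rfl fun b _ => ?_
    ring
  have hjd₀0 : j d₀ ≠ 0 := (map_ne_zero j).2 hd₀0
  have hdσ : ∀ i, σK ((![j d₀, d₁, ι d₁] : Fin 3 → K) i) = (![j d₀, d₁, ι d₁] : Fin 3 → K) i := by
    intro i
    fin_cases i
    · show σK (j d₀) = j d₀
      rw [hσj, hσd₀]
    · exact hd₁σ
    · show σK (ι d₁) = ι d₁
      rw [hσKι, hd₁σ]
  have hdne : ∀ i, (![j d₀, d₁, ι d₁] : Fin 3 → K) i ≠ 0 := by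
    intro i
    fin_cases i
    · exact hjd₀0
    · exact hd₁0
    · exact (map_ne_zero ι).2 hd₁0
  have hιd0 : ι ((![j d₀, d₁, ι d₁] : Fin 3 → K) 0) = (![j d₀, d₁, ι d₁] : Fin 3 → K) 0 := hιj d₀
  have hιd1 : ι ((![j d₀, d₁, ι d₁] : Fin 3 → K) 1) = (![j d₀, d₁, ι d₁] : Fin 3 → K) 2 := rfl
  /- §5 the parity of the frame, W-UNIT docking (★ `WildSeamDockings`): `log|j d₀|` even AND `½ log|j d₀| + log|d₁| + log|λ − ιλ|` even -/
  have hJK : Valued.v ((J : Matrix (Fin 3) (Fin 3) E).map j).det = 1 := by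
    rw [← RingHom.mapMatrix_apply, ← RingHom.map_det, hjv, (v_eq_one_iff_valuation_eq_one _).2 (valuation_det_eq_one_of_mem_glInt hJ), one_pow]
  have hGram' : ((P : Matrix (Fin 3) (Fin 3) K).map σK)ᵀ * ((J : Matrix (Fin 3) (Fin 3) E).map j) * (P : Matrix (Fin 3) (Fin 3) K) = diagonal ![j d₀, d₁, ι d₁] := hGram
  obtain ⟨hd0, hΦL⟩ := WildSeamDockings.even_half_log_add_log_add_of_symmetric_frame_of_skew_sq σK hσKv ι hιι hrE hια hα hw
    (((J : Matrix (Fin 3) (Fin 3) E)).map j) (P : Matrix (Fin 3) (Fin 3) K) ![j d₀, d₁, ι d₁] hGram' hjd₀0 hd₁0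
    (by show Valued.v (ι d₁) = Valued.v d₁; exact hιv d₁) (Matrix.isUnits_det_units P).ne_zero hJK hP0 hP1 hP2 (γ := lam)
    (fun h => hne h) (L := WithZero.log (Valued.v (lam - ι lam))) rfl
  /- §6 seam ∘ core, then `½ log|j d₀|_K = log|d₀|_E` -/
  obtain ⟨b, hbv, hb⟩ := WildSeamDockings.exists_v_eq_add_map_eq_one hσσ hωtr
  have htr : ∃ b : 𝒪[E], (b : E) + σ b = 1 := ⟨⟨b, (v_le_one_iff_mem_integer b).1 (hbv ▸ hω)⟩, hb⟩
  obtain ⟨hωK, hωKtr, hιωK⟩ := WildSeamDockings.seed_map j hjv hσj hιj hω hωtr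
  refine (exists_selfDual_cyclic_iff_exists_rational_good σ hσσ hσO htr hnorm J hJ hJh τ j hjO σK hσj hσKv' ι hιι hιj' P hτ hGram hP0 hP1 hP2
    hγO hinj hσγ hr).trans ?_
  refine (exists_rational_good_iff_even_uniform 𝒪[K] (fun x => (v_le_one_iff_mem_integer x).symm) σK ι hσKσK hσKι hσKv hιv hnK hnE hrE hγ1 hσγ hinj hιγ0 hιγ1 hιγ2
    hdσ hdne hιd0 hιd1 hωK hωKtr hιωK h01' h12' hd0 hΦL).trans ?_
  have hlog : WithZero.log (Valued.v ((![j d₀, d₁, ι d₁] : Fin 3 → K) 0)) / 2 = WithZero.log (Valued.v d₀) := by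
    show WithZero.log (Valued.v (j d₀)) / 2 = _
    rw [hjv, WithZero.log_pow, nsmul_eq_mul, Nat.cast_ofNat, Int.mul_ediv_cancel_left _ two_ne_zero]
  rw [hlog]

end Literature.NumberTheory.Automorphic.SymmetricEigenframe

end
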